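import Mathlib

/-!
# AtomicCalibrationR (stmt-QuantumFields-28169), E2 `stub_offDiagonalWhitney` — factorial bookkeeping for the `α Cⁿ (n!)^γ` budget
# (roadmap v2 item B.3 / v3 addendum; prover w4 g22, free hands)

`WhitneyPkg` allows constants `α Cⁿ (n!)^γ`.  Construction (T) produces factors `n^{a·n}` and `((N'·n)!)^s` (derivative budget
`N'·n`).  These are admissible by the elementary bounds below (`n^n ≤ eⁿ n!`):

* `pow_self_le_exp_mul_factorial` — `n^n ≤ e^n · n!`;
* `pow_mul_self_le` — `n^{N'n} ≤ e^{N'n} (n!)^{N'}`;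
* `factorial_mul_le_admissible` — `(N'n)! ≤ (N'e)^{N'n} (n!)^{N'}`, i.e. `Cⁿ (n!)^γ` with `C = (N'e)^{N'}`, `γ = N'`.

Mathlib only; no stub/crux/rung/summit is closed; nothing here touches Yang–Mills; the YM mass gap is NOT proved. [folklore]
-/

set_option autoImplicit false

noncomputable section

open scoped Nat

namespace Summit.QuantumFields.YangMills.Cruxes.AtomicCalibrationR.FactorialBookkeeping

/-- `n^n ≤ e^n · n!`. -/
theorem pow_self_le_exp_mul_factorial (n : ℕ) : (n : ℝ) ^ n ≤ Real.exp n * (n ! : ℝ) := by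
  have h := Real.pow_div_factorial_le_exp (x := (n : ℝ)) (Nat.cast_nonneg n) n
  have hf : (0 : ℝ) < (n ! : ℝ) := by exact_mod_cast Nat.factorial_pos n
  rwa [div_le_iff₀ hf] at h

/-- `n^{N'n} ≤ e^{N'n} (n!)^{N'}`. -/
theorem pow_mul_self_le (N' n : ℕ) : (n : ℝ) ^ (N' * n) ≤ Real.exp ((N' * n : ℕ) : ℝ) * (n ! : ℝ) ^ N' := by
  have h := pow_self_le_exp_mul_factorial n
  have h0 : (0 : ℝ) ≤ (n : ℝ) ^ n := by positivity
  calc (n : ℝ) ^ (N' * n) = ((n : ℝ) ^ n) ^ N' := by rw [mul_comm, pow_mul]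
    _ ≤ (Real.exp n * (n ! : ℝ)) ^ N' := pow_le_pow_left₀ h0 h N'
    _ = Real.exp ((N' * n : ℕ) : ℝ) * (n ! : ℝ) ^ N' := by
        rw [mul_pow, ← Real.exp_nat_mul]; push_cast; ring_nf

/-- **Admissibility of the budget factorial**: `(N'n)! ≤ (N' e)^{N'n} (n!)^{N'}`. [folklore] -/
theorem factorial_mul_le_admissible (N' n : ℕ) :
    ((N' * n) ! : ℝ) ≤ ((N' : ℝ) * Real.exp 1) ^ (N' * n) * (n ! : ℝ) ^ N' := by
  have h1 : ((N' * n) ! : ℝ) ≤ ((N' * n : ℕ) : ℝ) ^ (N' * n) := by exact_mod_cast Nat.factorial_le_pow (N' * n)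
  refine h1.trans ?_
  have h2 := pow_mul_self_le N' n
  have hN : (0 : ℝ) ≤ (N' : ℝ) ^ (N' * n) := by positivity
  calc ((N' * n : ℕ) : ℝ) ^ (N' * n) = (N' : ℝ) ^ (N' * n) * (n : ℝ) ^ (N' * n) := by rw [Nat.cast_mul, mul_pow]
    _ ≤ (N' : ℝ) ^ (N' * n) * (Real.exp ((N' * n : ℕ) : ℝ) * (n ! : ℝ) ^ N') := mul_le_mul_of_nonneg_left h2 hN
    _ = ((N' : ℝ) * Real.exp 1) ^ (N' * n) * (n ! : ℝ) ^ N' := by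
        rw [mul_pow, ← Real.exp_one_pow]; ring

end Summit.QuantumFields.YangMills.Cruxes.AtomicCalibrationR.FactorialBookkeeping

end
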